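import Literature.Barriers.QuantumAdvantage.TensorNetworkContraction
import Literature.Computability.QuantumComplexity.LightCone
import HarnessLib

/-!
# Markov–Shi Cor. 1.5 at the language level: reduction of both typed forms to one machine fact about small light cones

Sibling of the barrier file `Literature/Barriers/QuantumAdvantage/TensorNetworkContraction.lean`
(named facts `markovShi2008_cor15`, `markovShi2008_cor15_anyOrder`; the reduction
`markovShi2008_cor15_of_anyOrder`) and of `Literature/Computability/QuantumComplexity/LightCone.lean`
(`LightCone.cone`, `LightCone.card_cone_le`: under `q`-locality w.r.t. any ordering the backward
light cone of one wire of a depth-`D` circuit has `≤ 2qD + 1` wires). The discharge of Cor. 1.5 at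
the language level splits into

* MATHEMATICS, in the tree: the acceptance probability of wire `0` is that of its light cone
  (`LightCone.acceptProb_eq_acceptProb_cone`, `LightCone.acceptProb_eq_acceptProb_filter`), the cone
  of a `q`-local circuit of depth `≤ c log₂ n + c` has `O(log n)` wires (`LightCone.card_cone_le`),
  and the amplitudes of the cone circuit are computed exactly by the integer DP over `ℤ[ω]`
  (`StateVectorDP.lean`: `dpRun_spec`, `half_lt_probAcc_iff`);
* ONE MACHINE FACT, isolated here as the named fact `smallConeDecidable`: for a polynomial-time
  uniform oracle-free Clifford+`T` family whose wire-`0` light cones have `≤ k log₂ n + k` wires,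
  the threshold language `{x | P[wire 0 = 1] > 1/2}` is decidable in polynomial time (the
  `2^{O(log n)}`-dimensional state vector of the cone, propagated exactly — Markov–Shi's
  "deterministic simulation" in the degenerate case of a circuit on `O(log n)` qubits, Cor. 1.2 /
  Thm. 1.1 with treewidth `O(log n)`; the polynomial-time TM2 realisation is the sequel's job);
* the ASSEMBLY, proved here: `markovShi2008_cor15_anyOrder_of_smallConeDecidable` and
  `markovShi2008_cor15_of_smallConeDecidable` — under the `(2/3, 1/3)` gap the decided language IS
  the threshold language (`setOf_half_lt_eq_of_gap`), so `L ∈ P` (`mem_P_iff_holds`).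

So `smallConeDecidable_holds` (to come) discharges both typed forms of Cor. 1.5 at once.

## References

* I. L. Markov, Y. Shi, *Simulating quantum computation by contracting tensor networks*, SIAM J.
  Comput. 38 (2008) 963–981, §1: Thm. 1.1 and Cor. 1.2 (logarithmic treewidth ⟹ polynomial-time
  deterministic simulation, i.e. exact outcome probabilities), Cor. 1.5 (`q`-local-interacting,
  logarithmic depth), §5 ("`r = O(qD)`").
* M. A. Nielsen, I. L. Chuang, *Quantum Computation and Quantum Information*, CUP 2010, §4.5.5
  (classical simulation by storing the `2ⁿ` amplitudes).
-/

noncomputable section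

namespace Literature.Barriers.QuantumAdvantage

open _root_.Computability Literature.Computability.Complexity Literature.Computability.Complexity.Classes
  Literature.Computability.Cryptography Literature.Computability.QuantumComplexity

/-- **The machine fact behind Cor. 1.5 at the language level (small light cones are decidable).**
For every polynomial-time uniform, oracle-free family `F` of Clifford+`T` circuits and every `k`:
if for every input length `n` (nonempty register) the backward light cone of wire `0` of
`F.circ n` has at most `k · log₂ n + k` wires, then the threshold language
`{x | 1/2 < P[wire 0 of F.circ |x| on |x 0…0⟩ reads 1]}` is decidable in deterministic polynomial
time — by computing the `≤ 2 · n^k`-dimensional state vector of the cone circuit exactly over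
`ℤ[ω]/√2^h` (`StateVectorDP.dpRun_spec`, `half_lt_probAcc_iff`; the cone circuit has the same
acceptance probability, `LightCone.acceptProb_eq_acceptProb_cone`). This is the degenerate
`O(log n)`-qubit instance of Markov–Shi's deterministic simulation (Thm. 1.1 / Cor. 1.2: treewidth
`O(log n)` ⟹ polynomial time); its TM2 realisation is the remaining work of the discharge.
[cite: MarkovShi2008, §1 (Thm. 1.1, Cor. 1.2, Cor. 1.5)] -/
def smallConeDecidable : Prop :=
  ∀ (F : QCircuitFamily cliffordT) (k : ℕ), F.IsOracleFree → F.IsUniform →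
    (∀ (n : ℕ) (h : 0 < n + F.ancillas n),
      ((LightCone.cone (F.circ n).gates {⟨0, h⟩}).1).card ≤ k * Nat.log 2 n + k) →
    PolyTimeDecidable id {x : List Bool | 1 / 2 < F.acceptProbOn 0 x}

/-- **Under the `(2/3, 1/3)` gap the decided language is the threshold language** `{x | p(x) > 1/2}`.
[folklore] -/
theorem setOf_half_lt_eq_of_gap {F : QCircuitFamily cliffordT} {L : Language Bool}
    (hDec : ∀ x, (x ∈ L → 2 / 3 ≤ F.acceptProbOn 0 x) ∧ (x ∉ L → F.acceptProbOn 0 x ≤ 1 / 3)) :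
    {x : List Bool | 1 / 2 < F.acceptProbOn 0 x} = L := by
  ext x
  simp only [Set.mem_setOf_eq]
  constructor
  · intro hx
    by_contra hxL
    have := (hDec x).2 hxL
    linarith
  · intro hxL
    have := (hDec x).1 hxL
    linarith

/-- **The light cones of a `q`-local family of depth `≤ c log₂ n + c` have `≤ (2qc+1)(log₂ n + 1)`
wires** (`LightCone.card_cone_le`: `≤ 2q·depth + 1`). [cite: MarkovShi2008, §5 (r = O(qD))] -/
theorem card_cone_le_of_local_logDepth {q c : ℕ} {F : QCircuitFamily cliffordT}
    (hLoc : ∀ n, ∃ σ : Fin (n + F.ancillas n) ≃ Fin (n + F.ancillas n),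
      (F.circ n).IsLocalInteractingUnder σ q)
    (hD : ∀ n, (F.circ n).depth ≤ c * Nat.log 2 n + c) (n : ℕ) (h : 0 < n + F.ancillas n) :
    ((LightCone.cone (F.circ n).gates {⟨0, h⟩}).1).card ≤ (2 * q * c + 1) * Nat.log 2 n + (2 * q * c + 1) := by
  obtain ⟨σ, hσ⟩ := hLoc n
  have h1 := LightCone.card_cone_le σ q (F.circ n) hσ ⟨0, h⟩
  have h2 : q * (F.circ n).depth ≤ q * (c * Nat.log 2 n + c) := Nat.mul_le_mul_left q (hD n)
  have h3 : q * (c * Nat.log 2 n + c) = q * c * Nat.log 2 n + q * c := by ring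
  nlinarith [h1, h2, h3, Nat.zero_le (Nat.log 2 n)]

/-- **Cor. 1.5 (ordering-free form) from the machine fact.** Given `smallConeDecidable`, a
language decided with error `≤ 1/3` by a polynomial-time uniform, polynomial-size, oracle-free
Clifford+`T` family that is `q`-local-interacting under some ordering of the wires (per input
length) and of depth `≤ c log₂ n + c` is in `P`: its light cones have `O(log n)` wires
(`card_cone_le_of_local_logDepth`), so the threshold language is in `P`, and it equals `L`
(`setOf_half_lt_eq_of_gap`). [cite: MarkovShi2008, §1 (Cor. 1.5)] -/
theorem markovShi2008_cor15_anyOrder_of_smallConeDecidable (h : smallConeDecidable) :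
    markovShi2008_cor15_anyOrder := by
  intro q c F L hOF hU _hPS hLoc hD hDec
  have hdec := h F (2 * q * c + 1) hOF hU (card_cone_le_of_local_logDepth hLoc hD)
  rw [setOf_half_lt_eq_of_gap hDec] at hdec
  exact mem_P_iff_holds.2 hdec

/-- **Cor. 1.5 (typed, identity ordering) from the machine fact**, through
`markovShi2008_cor15_of_anyOrder`. [cite: MarkovShi2008, §1 (Cor. 1.5)] -/
theorem markovShi2008_cor15_of_smallConeDecidable (h : smallConeDecidable) : markovShi2008_cor15 :=
  markovShi2008_cor15_of_anyOrder (markovShi2008_cor15_anyOrder_of_smallConeDecidable h)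

end Literature.Barriers.QuantumAdvantage

end
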